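import Mathlib
import HarnessLib
import Summits.AtomisticToContinuum.FouriersLaw.Theorems.EmbeddedDrudeMourreMourreDissolutionFgrCesaroReduction

/-!
# Stub `stub_envelopeOfSpectralAbelBound` of line `SpikeLemma` (crux `CoercivePulse.LinearCeiling`,
# stmt-AtomisticToContinuum-15383): an Abel ceiling forces a linear ceiling on the Helfand envelope

Support file (`--supports stmt-AtomisticToContinuum-15383`, closes nothing). Pure real analysis: Mathlib
and the landed Fejér–Poisson comparison `MourreDissolution.fejerMean_le_four_mul_abelMean`
(`∫₀^{1/ν} (1 - νs) C(s) ds ≤ 4 ∫_{s>0} e^{-νs} C(s) ds` for the cosine transform `C` of a finite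
measure, file `Theorems/EmbeddedDrudeMourreMourreDissolutionFgrCesaroReduction.lean`; it rests on the
Fubini lemma `AbelOfSpectralDensity.integral_exp_neg_mul_cosTransform` and the kernel domination
`(1 - cos y)(1 + y²) ≤ 4y²`).

Statement. Let `σ` be a finite measure on `ℝ`, `C(t) = ∫ cos(ωt) dσ(ω)` its cosine transform, and
suppose the Abel means are bounded above on a frequency window, `∫_{t>0} e^{-νt} C(t) dt ≤ B` for
`ν ∈ (0, ν₀)`. Then the Helfand envelope `V(t) := 2∫_{(0,t]} (t-u) C(u) du` has a linear ceiling: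
there is `b` with `V(t) ≤ b·t` for all `t ≥ 0`; here `b = 8·max(B,0) + 2σ(ℝ)ν₀⁻¹`.

Proof.
* Large times `t > ν₀⁻¹`: put `ν = t⁻¹ ∈ (0, ν₀)`. Since `(t-u) = t(1 - u/t)`,
  `V(t) = 2t ∫₀^t (1 - u/t) C(u) du ≤ 2t · 4 ∫_{s>0} e^{-s/t} C(s) ds ≤ 8t·B ≤ 8·max(B,0)·t`
  (Cesàro ≤ 4·Abel, then the Abel ceiling at `ν = t⁻¹`).
* Small times `0 ≤ t ≤ ν₀⁻¹`: `|C(u)| ≤ σ(ℝ)` (`|cos| ≤ 1`), so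
  `V(t) ≤ 2 · (t σ(ℝ)) · t ≤ 2σ(ℝ)ν₀⁻¹ · t`.

References: folklore (comparison of the Fejér kernel `(1 - cos(ωt))/(tω²)` with the Poisson kernel
`ν/(ν²+ω²)` on the spectral side; Helfand 1960 for the envelope). No definitions, no named facts,
no sorry.
-/

noncomputable section

namespace Summit.AtomisticToContinuum.FouriersLaw.Theorems.LinearCeiling.SpikeLemma

open MeasureTheory Filter Set
open scoped Topology BigOperators

/-- The cosine transform of a finite measure is bounded by the total mass:
`‖∫ cos(ωu) dσ(ω)‖ ≤ σ(ℝ)`. [folklore] -/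
theorem norm_cosTransform_le (σ : Measure ℝ) [IsFiniteMeasure σ] (u : ℝ) :
    ‖∫ ω, Real.cos (ω * u) ∂σ‖ ≤ σ.real univ := by
  have h := norm_integral_le_of_norm_le_const (μ := σ) (C := 1)
    (f := fun ω : ℝ => Real.cos (ω * u))
    (ae_of_all _ (fun ω => (Real.norm_eq_abs _).le.trans (Real.abs_cos_le_one _)))
  simpa using h

/-- Crude quadratic bound on the Helfand envelope: if `‖C u‖ ≤ M` for all `u`, then for `0 ≤ t`
`‖∫_{(0,t]} (t-u) C(u) du‖ ≤ (t·M)·t` (the integrand is bounded by `t·M` on a set of Lebesgue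
measure `t`). [folklore] -/
theorem norm_setIntegral_sub_mul_le {C : ℝ → ℝ} {M : ℝ} (hCb : ∀ u : ℝ, ‖C u‖ ≤ M) {t : ℝ}
    (ht : 0 ≤ t) : ‖∫ u in Ioc (0:ℝ) t, (t - u) * C u‖ ≤ t * M * t := by
  have hb : ∀ u ∈ Ioc (0:ℝ) t, ‖(t - u) * C u‖ ≤ t * M := fun u hu => by
    rw [norm_mul, Real.norm_eq_abs, abs_of_nonneg (sub_nonneg.2 hu.2)]
    exact mul_le_mul (by linarith [hu.1]) (hCb u) (norm_nonneg _) ht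
  have h := norm_setIntegral_le_of_norm_le_const (μ := volume) measure_Ioc_lt_top hb
  rwa [Real.volume_real_Ioc_of_le ht, sub_zero] at h

/-- The Helfand envelope is `t` times a Fejér mean: for `t ≠ 0`,
`∫_{(0,t]} (t-u) C(u) du = t · ∫_{(0,t]} (1 - u/t) C(u) du`. [folklore] -/
theorem setIntegral_sub_mul_eq_mul_fejer (C : ℝ → ℝ) {t : ℝ} (ht : t ≠ 0) :
    ∫ u in Ioc (0:ℝ) t, (t - u) * C u = t * ∫ u in Ioc (0:ℝ) t, (1 - u / t) * C u := by
  rw [← integral_const_mul]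
  refine setIntegral_congr_fun measurableSet_Ioc (fun u _ => ?_)
  rw [← mul_assoc, mul_sub, mul_one, mul_div_cancel₀ _ ht]

/-- **Registered stub `stub_envelopeOfSpectralAbelBound` of line `SpikeLemma`** (exact registered
signature): if `C = ∫ cos(ω·) dσ(ω)` for a finite measure `σ` and the Abel means of `C` are bounded
above, `∫_{t>0} e^{-νt} C(t) dt ≤ B` for `ν ∈ (0, ν₀)`, then the Helfand envelope has a linear
ceiling: `2∫_{(0,t]} (t-u) C(u) du ≤ b·t` for all `t ≥ 0`, with `b = 8·max(B,0) + 2σ(ℝ)ν₀⁻¹`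
(for `t > ν₀⁻¹`: Cesàro ≤ 4·Abel at `ν = t⁻¹`, `MourreDissolution.fejerMean_le_four_mul_abelMean`;
for `t ≤ ν₀⁻¹`: `|C| ≤ σ(ℝ)`). [folklore] -/
theorem stub_envelopeOfSpectralAbelBound :
    ∀ σ : MeasureTheory.Measure ℝ, MeasureTheory.IsFiniteMeasure σ → ∀ C : ℝ → ℝ,
      (∀ t : ℝ, C t = ∫ ω, Real.cos (ω * t) ∂σ) → ∀ B ν₀ : ℝ, 0 < ν₀ →
      (∀ ν : ℝ, 0 < ν → ν < ν₀ → ∫ t in Set.Ioi (0:ℝ), Real.exp (-(ν * t)) * C t ≤ B) →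
      ∃ b : ℝ, ∀ t : ℝ, 0 ≤ t → 2 * ∫ u in Set.Ioc (0:ℝ) t, (t - u) * C u ≤ b * t := by
  intro σ hσ C hC B ν₀ hν₀ hA
  refine ⟨8 * max B 0 + 2 * σ.real univ * ν₀⁻¹, fun t ht => ?_⟩
  have hb₁ : 0 ≤ 8 * max B 0 := by positivity
  have hb₂ : 0 ≤ 2 * σ.real univ * ν₀⁻¹ := by positivity
  rcases le_or_gt t ν₀⁻¹ with hsmall | hlarge
  · -- small times: the crude bound `|C| ≤ σ(ℝ)`
    have hCb : ∀ u : ℝ, ‖C u‖ ≤ σ.real univ := fun u => by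
      rw [hC u]
      exact norm_cosTransform_le σ u
    have h1 := (Real.le_norm_self _).trans (norm_setIntegral_sub_mul_le hCb ht)
    calc 2 * ∫ u in Ioc (0:ℝ) t, (t - u) * C u ≤ 2 * (t * σ.real univ * t) := by linarith
      _ ≤ 2 * (t * σ.real univ * ν₀⁻¹) := by gcongr
      _ = (2 * σ.real univ * ν₀⁻¹) * t := by ring
      _ ≤ (8 * max B 0 + 2 * σ.real univ * ν₀⁻¹) * t := by nlinarith [mul_nonneg hb₁ ht]
  · -- large times: Cesàro ≤ 4·Abel at `ν = t⁻¹ ∈ (0, ν₀)`, then the Abel ceiling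
    have htpos : 0 < t := lt_trans (inv_pos.2 hν₀) hlarge
    have hν : 0 < t⁻¹ := inv_pos.2 htpos
    have hνν₀ : t⁻¹ < ν₀ := (inv_lt_comm₀ htpos hν₀).2 hlarge
    have hF :=
      Summit.AtomisticToContinuum.FouriersLaw.Theorems.MourreDissolution.fejerMean_le_four_mul_abelMean
        σ hC hν
    rw [inv_inv, intervalIntegral.integral_of_le htpos.le] at hF
    have hAB := hA t⁻¹ hν hνν₀
    calc 2 * ∫ u in Ioc (0:ℝ) t, (t - u) * C u
        = 2 * t * ∫ u in Ioc (0:ℝ) t, (1 - u / t) * C u := by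
          rw [setIntegral_sub_mul_eq_mul_fejer C htpos.ne']; ring
      _ ≤ 2 * t * (4 * max B 0) := by
          gcongr
          exact hF.trans (by linarith [le_max_left B 0])
      _ = (8 * max B 0) * t := by ring
      _ ≤ (8 * max B 0 + 2 * σ.real univ * ν₀⁻¹) * t := by nlinarith [mul_nonneg hb₂ ht]

end Summit.AtomisticToContinuum.FouriersLaw.Theorems.LinearCeiling.SpikeLemma
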